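import Summits.QuantumFields.YangMills.Theorems.BalabanLadderNTMarkovMirrorChiralPackage
import HarnessLib

/-!
# Crux `UVSeamRec` (stmt-QuantumFields-20043), stub `stub_floorsEngine` (S-B) / crux `NT` clause (i):
# the Markov–mirror one-point package WITHOUT its shell data — the bare mirror floor

Helper file (`--supports stmt-QuantumFields-20043`) of the seam stub-prover row `ym-20043-seam-s1` (owner
RULING R75: the Markov–mirror one-point package {RBL+SUP, RBLΔ, SF} of card
`Cruxes/NT/Ideas/markov-mirror-dirichlet-response.md` in its natural generality — compact `G`, any lattice
representation `r`, the unit map a parameter).  Sequel of the series `BalabanLadderNTMarkovMirror*` (p505063 –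
p512282).

The package of `Q2_floor_of_mirrorPackage_chiral` (p509898) carries, per coupling, shell data `(p β, 𝒢_β)`:
a reference value and a bounded continuous cylinder functional on the closed collar of the cube `Q_β`, with
(RBL+SUP) `|kerE_{Q_β}^ζ(Ṽ) − p β + 𝒢_β ζ| ≤ √ε/2` for every exterior `ζ` and (SF) `4ε ≤ Cov_T(𝒢_β∘Θ₀, 𝒢_β)` on
every large torus.  This file records the converse bookkeeping of `mirrorCov_ge_of_boundaryResponse` (p507216):
for ANY bounded continuous cylinder `W` carried by a positive-time cube `Q` and ANY reference value `p`, the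
**canonical shell functional** `𝒢 := p − kerE_Q^·(W)` is admissible (Feller continuity `Reference.continuous_kerE`,
bound `BoundaryLaw.abs_kerE_le`, quasilocality `isCylinder_kerE` with links in the window `[c − 1, c + b]`), satisfies
(RBL+SUP) with error `0`, and its shell covariance IS the bare mirror covariance of `W`:
`Cov_T(𝒢∘Θ₀, 𝒢) = Cov_T(kerE_Q(W)∘Θ₀, kerE_Q(W)) = Cov_T(W∘Θ₀, W)` (affine recentring + the mirror form p506289).
Consequently, with `𝒢` quantified existentially (as in the hypothesis of p512282
`MarkovMirrorFloors.stubFloorsEngine_of_mirrorPackage_rF`), the pair {RBL+SUP, SF} is EQUIVALENT to the single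
two-point hypothesis

* (MF) `X ≤ Cov_T(Ṽ_v∘Θ₀, Ṽ_v)` on every torus `aβ·L ≥ Λ₅` — the bare lattice mirror floor of the smeared action
  density carried by ONE cube per coupling —

up to the constants `4 ↔ 9/4` (`mirrorPackage_of_bareFloor` here; `mirrorCov_ge_of_boundaryResponse` there), and the
clause-(i) package of the line reads {RBLΔ (⇐ BL6 ⇐ FBL6), MF}: `Q2_floor_of_bareFloor_chiral`,
`lowerBounds_fst_of_bareFloor_chiral`, `floorsTwoPoint_of_bareFloor_chiral` (the two-point conjunct of the
registered `UVSeamRec.stub_floorsEngine`, v4-F f523973980851859, for any `(G, r, a)`), `nt_of_bareFloor_chiral`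
(`Theses.BalabanLadder.NT` BY NAME).  Located reading (no registry content): the one-point data {RBL+SUP, SF}
carry information beyond (MF) only once `𝒢` is PINNED (card E: the `v`-weighted classical Dirichlet excess of the
boundary data; or an affine functional of the collar plaquette fields); nothing in this file is `SU(2)`-specific.

* §1 `torusCov_const_sub` — the mirror covariance is invariant under affine recentring of both slots;
* §2 `continuous_const_sub_kerE`, `abs_const_sub_kerE_le`, `isCylinder_const_sub_kerE`, `const_sub_kerE_window` —
  admissibility of the canonical shell functional; `torusFit_of_geom` (a cube of physical size `≤ Λ₅ ≤ aβ·L` and its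
  closed collar fit in the torus box);
* §3 `mirrorPackage_of_bareFloor` — (MF) ⇒ (SF) for the canonical shell functional, per coupling and torus;
* §4 the asymptotic packaging along a unit map.

Honest status: (MF), RBLΔ's supplier BL6/FBL6 and clause (ii) are engine-grade inputs (card E category c′; crux `NT`);
this file proves bookkeeping only.  Refs: card E (Mechanism 1–5); Osterwalder–Seiler 1978 §2; Glimm–Jaffe 1987 §6.1.
-/

set_option autoImplicit false

noncomputable section

open scoped SchwartzMap
open MeasureTheory Filter Topology
open Literature.MathematicalPhysics.QuantumFieldTheory Literature.MathematicalPhysics.QuantumLattice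
open Literature.Probability.LatticeModels
open Summit.QuantumFields.YangMills.Cruxes.OSLegsFromFemtoAndGap.DlrCollarTransfer
open Summit.QuantumFields.YangMills.Cruxes.NT.Reference (continuous_kerE continuous_kerE_torusLift)
open Summit.QuantumFields.YangMills.Cruxes.NT.BoundaryLaw (abs_kerE_le)
open Summit.QuantumFields.YangMills.Cruxes.NT.Reflection (integrable_wilson_of_bdd)

namespace Summit.QuantumFields.YangMills.Cruxes.NT.MarkovMirror

/-! ## §0 Geometry: a cube of bounded physical size and its closed collar fit in a large torus -/

/-- **Torus fit.**  If the cube `(c, b)` has physical size `(|c j| + b + 3)·a ≤ Λ₅` in every direction and the torus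
`2L+1` is large, `Λ₅ ≤ a·L` (`0 < a`), then `c 0 + b + 3 ≤ L` and `−L + 2 ≤ c j`, `c j + b + 2 ≤ L + 1` — the side
conditions of the mirror form `torusCov_reflect_lift_eq_torusCov_reflect_kerE`. [folklore] -/
theorem torusFit_of_geom {a Λ₅ : ℝ} (ha : 0 < a) {c : Fin 4 → ℤ} {b L : ℕ}
    (hsize : ∀ j : Fin 4, (|((c j : ℤ) : ℝ)| + (b : ℝ) + 3) * a ≤ Λ₅) (hL : Λ₅ ≤ a * L) :
    c 0 + (b : ℤ) + 3 ≤ L ∧ ∀ j : Fin 4, -(L : ℤ) + 2 ≤ c j ∧ c j + (b : ℤ) + 2 ≤ (L : ℤ) + 1 := by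
  have hfit : ∀ j : Fin 4, |((c j : ℤ) : ℝ)| + (b : ℝ) + 3 ≤ (L : ℝ) := fun j =>
    le_of_mul_le_mul_right (by nlinarith [hsize j, hL]) ha
  have hfitZ : ∀ j : Fin 4, |c j| + (b : ℤ) + 3 ≤ (L : ℤ) := fun j => by
    have h := hfit j
    rw [Int.cast_abs.symm] at h
    exact_mod_cast h
  refine ⟨by linarith [hfitZ 0, le_abs_self (c 0)], fun j => ?_⟩
  have h := hfitZ j
  have h1 := le_abs_self (c j)
  have h2 := neg_abs_le (c j)
  constructor <;> linarith

section Bare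

variable (G : Type) [Group G] [TopologicalSpace G] [IsTopologicalGroup G] [CompactSpace G]
  [MeasurableSpace G] [BorelSpace G] (r : LatticeRep G)

/-! ## §1 The mirror covariance is invariant under affine recentring of both slots -/

/-- **Affine recentring.**  For bounded continuous observables `A` (read on the reflected field) and `B` of `ℤ⁴`
configurations and constants `p, q`, on the torus of side `2L+1` (read through the periodic lift)
`Cov_T(p − A, q − B) = Cov_T(A, B)`:  `torusE((p − A)(q − B)) − torusE(p − A)·torusE(q − B) =
torusE(A·B) − torusE(A)·torusE(B)`.  Wilson's torus measure is a probability measure, so constants integrate to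
themselves. [folklore] -/
theorem torusCov_const_sub (β : ℝ) (L : ℕ) {A B : LGConfig 4 G → ℝ} (hA : Continuous A) (hB : Continuous B)
    {MA MB : ℝ} (hMA : ∀ U, |A U| ≤ MA) (hMB : ∀ U, |B U| ≤ MB) (p q : ℝ) :
    torusE G r β L (fun V => (p - A V) * (q - B V)) -
        torusE G r β L (fun V => p - A V) * torusE G r β L (fun V => q - B V) =
      torusE G r β L (fun V => A V * B V) - torusE G r β L A * torusE G r β L B := by
  haveI := r.secondCountableTopology
  haveI := isProbabilityMeasure_wilsonMeasure (d := 4) (L := 2 * L + 1) r.ρ r.continuous β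
  unfold torusE
  set μ := wilsonMeasure (d := 4) (L := 2 * L + 1) r.ρ β with hμ
  set a : GaugeConfig 4 (2 * L + 1) G → ℝ := fun U => A (torusLift (2 * L + 1) U) with ha
  set b' : GaugeConfig 4 (2 * L + 1) G → ℝ := fun U => B (torusLift (2 * L + 1) U) with hb'
  have hac : Continuous a := hA.comp (continuous_torusLift _)
  have hbc : Continuous b' := hB.comp (continuous_torusLift _)
  have ia : Integrable a μ := integrable_wilson_of_bdd r.ρ r.continuous β hac.measurable ⟨MA, fun U => hMA _⟩
  have ib : Integrable b' μ := integrable_wilson_of_bdd r.ρ r.continuous β hbc.measurable ⟨MB, fun U => hMB _⟩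
  have iab : Integrable (fun U => a U * b' U) μ :=
    integrable_wilson_of_bdd r.ρ r.continuous β (hac.mul hbc).measurable ⟨MA * MB, fun U => by
      rw [abs_mul]
      exact mul_le_mul (hMA (torusLift (2 * L + 1) U)) (hMB (torusLift (2 * L + 1) U)) (abs_nonneg _)
        ((abs_nonneg _).trans (hMA (torusLift (2 * L + 1) U)))⟩
  change (∫ U, (p - a U) * (q - b' U) ∂μ) - (∫ U, (p - a U) ∂μ) * (∫ U, (q - b' U) ∂μ) =
    (∫ U, a U * b' U ∂μ) - (∫ U, a U ∂μ) * (∫ U, b' U ∂μ)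
  have hpa : ∫ U, (p - a U) ∂μ = p - ∫ U, a U ∂μ := by
    rw [integral_sub (integrable_const p) ia, integral_const, smul_eq_mul, probReal_univ, one_mul]
  have hqb : ∫ U, (q - b' U) ∂μ = q - ∫ U, b' U ∂μ := by
    rw [integral_sub (integrable_const q) ib, integral_const, smul_eq_mul, probReal_univ, one_mul]
  have hprod : ∫ U, (p - a U) * (q - b' U) ∂μ =
      p * q - p * ∫ U, b' U ∂μ - q * ∫ U, a U ∂μ + ∫ U, a U * b' U ∂μ := by
    have e1 : (fun U => (p - a U) * (q - b' U)) = fun U => ((p * q - p * b' U) - q * a U) + a U * b' U := by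
      funext U; ring
    have i1 : Integrable (fun U => p * q - p * b' U) μ := (integrable_const _).sub (ib.const_mul p)
    have i2 : Integrable (fun U => (p * q - p * b' U) - q * a U) μ := i1.sub (ia.const_mul q)
    rw [e1, integral_add i2 iab, integral_sub i1 (ia.const_mul q), integral_sub (integrable_const _) (ib.const_mul p),
      integral_const, smul_eq_mul, probReal_univ, one_mul, integral_const_mul, integral_const_mul]
  rw [hprod, hpa, hqb]
  ring

/-! ## §2 The canonical shell functional `p − kerE_Q(W)`: admissibility -/

/-- **Continuity** of the canonical shell functional `ζ ↦ p − kerE_Q^ζ(W)` for a bounded continuous `W` (the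
Feller property of the lattice Yang–Mills cube kernel, `Reference.continuous_kerE`). [folklore] -/
theorem continuous_const_sub_kerE (β : ℝ) (c : Fin 4 → ℤ) (b : ℕ) {W : LGConfig 4 G → ℝ} (hWc : Continuous W)
    {MW : ℝ} (hMW : ∀ U, |W U| ≤ MW) (p : ℝ) :
    Continuous fun ζ => p - kerE G r β c b ζ W :=
  continuous_const.sub (continuous_kerE G r β c b hWc hMW)

/-- **Bound** `|p − kerE_Q^ζ(W)| ≤ |p| + M_W` (the kernel is a probability). [folklore] -/
theorem abs_const_sub_kerE_le (β : ℝ) (c : Fin 4 → ℤ) (b : ℕ) {W : LGConfig 4 G → ℝ}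
    {MW : ℝ} (hMW : ∀ U, |W U| ≤ MW) (p : ℝ) (ζ : LGConfig 4 G) :
    |p - kerE G r β c b ζ W| ≤ |p| + MW := by
  have h := abs_kerE_le G r β c b ζ hMW
  calc |p - kerE G r β c b ζ W| ≤ |p| + |kerE G r β c b ζ W| := abs_sub _ _
    _ ≤ |p| + MW := by linarith

/-- **Quasilocality**: the canonical shell functional is a cylinder functional of the exterior, supported on the
links of `W` and the collar of the cube (`isCylinder_kerE`). [folklore] -/
theorem isCylinder_const_sub_kerE (β : ℝ) (c : Fin 4 → ℤ) (b : ℕ) {W : LGConfig 4 G → ℝ} (hWm : Measurable W)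
    {SW : Finset (Literature.MathematicalPhysics.QuantumLattice.ZdEdge 4)} (hWS : IsCylinder W SW) (p : ℝ) :
    IsCylinder (fun ζ => p - kerE G r β c b ζ W)
      (SW ∪ (plaquettesTouching (cubeEdges c b)).biUnion plaquetteEdges) := by
  intro U V hUV
  simp only [isCylinder_kerE G r β c b hWm hWS hUV]

omit [TopologicalSpace G] [IsTopologicalGroup G] [CompactSpace G] [MeasurableSpace G] [BorelSpace G] in
/-- **Window**: if the links of `W` are based in the cube window `[c, c + b]`, the support of the canonical shell
functional is based in `[c − 1, c + b]`, inside the closed collar `[c − 1, c + b + 1]`. [folklore] -/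
theorem const_sub_kerE_window {c : Fin 4 → ℤ} {b : ℕ}
    {SW : Finset (Literature.MathematicalPhysics.QuantumLattice.ZdEdge 4)}
    (hSW : ∀ e ∈ SW, ∀ j, c j ≤ e.1 j ∧ e.1 j ≤ c j + b) :
    ∀ e ∈ SW ∪ (plaquettesTouching (cubeEdges c b)).biUnion plaquetteEdges, ∀ j : Fin 4,
      c j - 1 ≤ e.1 j ∧ e.1 j ≤ c j + b + 1 := fun e he j => by
  have h := kerE_supp_window hSW he j
  exact ⟨h.1, by linarith [h.2]⟩

/-! ## §3 (MF) ⇒ (SF) for the canonical shell functional, per coupling and torus -/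

/-- **The bare mirror floor feeds the shell floor of the canonical shell functional.**  A cube `Q = (c, b)` at
times `≥ 1` fitting the torus `2L+1` with its closed collar (`c 0 + b + 3 ≤ L`, `−L + 2 ≤ c j`, `c j + b + 2 ≤ L + 1`),
a bounded continuous cylinder `W` with links in `[c, c + b]`, any `p`.  If `X ≤ Cov_T(W∘Θ₀, W)` then
`X ≤ Cov_T(𝒢∘Θ₀, 𝒢)` for `𝒢 := p − kerE_Q(W)`: affine recentring (`torusCov_const_sub`) and the mirror form
`Cov_T(W∘Θ₀, W) = Cov_T(kerE_Q(W)∘Θ₀, kerE_Q(W))` (`torusCov_reflect_lift_eq_torusCov_reflect_kerE`).  Together with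
`|kerE_Q^ζ(W) − p + 𝒢 ζ| = 0` this is the converse of `mirrorCov_ge_of_boundaryResponse`. [folklore] -/
theorem mirrorPackage_of_bareFloor (β : ℝ) (c : Fin 4 → ℤ) (b L : ℕ) (hc0 : 1 ≤ c 0)
    (hcL : c 0 + (b : ℤ) + 3 ≤ L) (hc : ∀ j, -(L : ℤ) + 2 ≤ c j ∧ c j + (b : ℤ) + 2 ≤ (L : ℤ) + 1)
    {W : LGConfig 4 G → ℝ} (hWc : Continuous W) {MW : ℝ} (hMW : ∀ U, |W U| ≤ MW)
    {SW : Finset (Literature.MathematicalPhysics.QuantumLattice.ZdEdge 4)} (hWS : IsCylinder W SW)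
    (hSW : ∀ e ∈ SW, ∀ j, c j ≤ e.1 j ∧ e.1 j ≤ c j + b) (p : ℝ) {X : ℝ}
    (hX : X ≤ torusE G r β L (fun V => W (cfgReflect V) * W V) -
      torusE G r β L (fun V => W (cfgReflect V)) * torusE G r β L W) :
    X ≤ torusE G r β L (fun V => (p - kerE G r β c b (cfgReflect V) W) * (p - kerE G r β c b V W)) -
      torusE G r β L (fun V => p - kerE G r β c b (cfgReflect V) W) *
        torusE G r β L (fun V => p - kerE G r β c b V W) := by
  have hkc : Continuous fun η => kerE G r β c b η W := continuous_kerE G r β c b hWc hMW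
  have hkb : ∀ η, |kerE G r β c b η W| ≤ MW := fun η => abs_kerE_le G r β c b η hMW
  have h := torusCov_const_sub G r β L (A := fun V => kerE G r β c b (cfgReflect V) W)
    (B := fun V => kerE G r β c b V W) (hkc.comp continuous_cfgReflect) hkc (fun U => hkb _) hkb p p
  refine hX.trans_eq ?_
  rw [torusCov_reflect_lift_eq_torusCov_reflect_kerE G r β c b L hc0 hcL hc hWc hWc hMW hMW hWS hWS hSW hSW]
  exact h.symm

/-- **(RBL+SUP) with error zero** for the canonical shell functional (recorded in the `≤ δ` currency of the
package lemmas, any `0 ≤ δ`). [folklore] -/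
theorem rbl_const_sub_kerE (β : ℝ) (c : Fin 4 → ℤ) (b : ℕ) (W : LGConfig 4 G → ℝ) (p : ℝ) {δ : ℝ}
    (hδ : 0 ≤ δ) (ζ : LGConfig 4 G) :
    |kerE G r β c b ζ W - p + (p - kerE G r β c b ζ W)| ≤ δ := by
  have : kerE G r β c b ζ W - p + (p - kerE G r β c b ζ W) = 0 := by ring
  rw [this, abs_zero]
  exact hδ

/-! ## §4 Asymptotic packaging along a unit map: the clause-(i) package {RBLΔ, MF} -/

/-- **`Q2(θv, v) ≥ ε` for all large couplings and tori from {RBLΔ, MF}.**  A unit map `a > 0`, ONE test function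
`v`, `ε > 0`; for `β ≥ β₅`: a cube `Q_β = (c β, b β)` at times `≥ 1` of physical size `(|c β j| + b β + 3)·aβ ≤ Λ₅`
carrying the lattice support of `v(aβ·)` at depth `≥ 2`; a reference value `p' β` with
(RBLΔ) `|kerE_{Q_β}^ζ(Wᴿ) − kerE_{Q_β}^ζ(Ṽ) − p' β| ≤ √ε/2` for every exterior `ζ`, and
(MF) `4ε ≤ Cov_T(Ṽ∘Θ₀, Ṽ)` on every torus `2L+1` with `Λ₅ ≤ aβ·L`, `Ṽ = ∑_{y ∈ Q_β} v(aβ·y) dens_y`.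
Then `ε ≤ Q2 G r β L (a β) (θv) v` for `β ≥ max β₅ 0`, `Λ₅ ≤ aβ·L` — `Q2_floor_of_mirrorPackage_chiral` fed with the
canonical shell data `p := 0`, `𝒢_β := −kerE_{Q_β}(Ṽ)`. [folklore] -/
theorem Q2_floor_of_bareFloor_chiral (a : ℝ → ℝ) (ha₀ : ∀ β, 0 < a β)
    (v : 𝓢(EuclideanSpace ℝ (Fin 4), ℝ)) {ε : ℝ} (hε : 0 < ε) {β₅ Λ₅ : ℝ}
    (c : ℝ → (Fin 4 → ℤ)) (b : ℝ → ℕ) (p' : ℝ → ℝ)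
    (hgeom : ∀ β, β₅ ≤ β → 1 ≤ c β 0 ∧ ∀ j : Fin 4, (|((c β j : ℤ) : ℝ)| + (b β : ℝ) + 3) * a β ≤ Λ₅)
    (hsupp : ∀ β, β₅ ≤ β → ∀ x : Fin 4 → ℤ, v (a β • siteToE x) ≠ 0 →
      x ∈ cubeSites (c β) (b β) ∧ 2 ≤ depth (c β) (b β) x)
    (hΔ : ∀ β, β₅ ≤ β → ∀ ζ,
      |kerE G r β (c β) (b β) ζ (fun V => ∑ x ∈ cubeSites (c β) (b β), v (a β • siteToE x) *
          ∑ q : {q : Fin 4 × Fin 4 // q.1 < q.2}, plane G r q.1 (if q.1.1 = 0 then x - Pi.single 0 1 else x) V) -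
        kerE G r β (c β) (b β) ζ (fun V => ∑ y ∈ cubeSites (c β) (b β), v (a β • siteToE y) * dens G r y V) -
        p' β| ≤ Real.sqrt ε / 2)
    (hMF : ∀ β, β₅ ≤ β → ∀ L : ℕ, Λ₅ ≤ a β * L →
      4 * ε ≤ torusE G r β L (fun V =>
          (∑ y ∈ cubeSites (c β) (b β), v (a β • siteToE y) * dens G r y (cfgReflect V)) *
            ∑ y ∈ cubeSites (c β) (b β), v (a β • siteToE y) * dens G r y V) -
        torusE G r β L (fun V => ∑ y ∈ cubeSites (c β) (b β), v (a β • siteToE y) * dens G r y (cfgReflect V)) *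
          torusE G r β L (fun V => ∑ y ∈ cubeSites (c β) (b β), v (a β • siteToE y) * dens G r y V)) :
    ∀ β : ℝ, max β₅ 0 ≤ β → ∀ L : ℕ, Λ₅ ≤ a β * L → ε ≤ Q2 G r β L (a β) (thetaTest 4 v) v := by
  haveI := r.secondCountableTopology
  refine Q2_floor_of_mirrorPackage_chiral G r a ha₀ v hε c b (fun _ => 0) p'
    (fun β ζ => 0 - kerE G r β (c β) (b β) ζ
      (fun V => ∑ y ∈ cubeSites (c β) (b β), v (a β • siteToE y) * dens G r y V))
    hgeom hsupp (fun β _ => ?_) (fun β _ ζ => ?_) hΔ (fun β hβ L hL => ?_)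
  · -- admissibility of the canonical shell functional
    obtain ⟨MW, hMW⟩ := exists_abs_cubeSmear_le G r (c β) (b β) (fun y => v (a β • siteToE y))
    obtain ⟨SW, hWS, hSW⟩ := exists_isCylinder_cubeSmear G r (c β) (b β) (fun y => v (a β • siteToE y))
    have hWc := continuous_cubeSmear G r (c β) (b β) (fun y => v (a β • siteToE y))
    exact ⟨continuous_const_sub_kerE G r β (c β) (b β) hWc hMW 0,
      ⟨|(0 : ℝ)| + MW, fun U => abs_const_sub_kerE_le G r β (c β) (b β) hMW 0 U⟩,
      _, isCylinder_const_sub_kerE G r β (c β) (b β) hWc.measurable hWS 0, const_sub_kerE_window hSW⟩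
  · -- (RBL+SUP) with error zero
    exact rbl_const_sub_kerE G r β (c β) (b β) _ 0 (by positivity) ζ
  · -- (SF) from (MF)
    obtain ⟨hc0, hsize⟩ := hgeom β hβ
    obtain ⟨hcL, hc⟩ := torusFit_of_geom (ha₀ β) hsize hL
    obtain ⟨MW, hMW⟩ := exists_abs_cubeSmear_le G r (c β) (b β) (fun y => v (a β • siteToE y))
    obtain ⟨SW, hWS, hSW⟩ := exists_isCylinder_cubeSmear G r (c β) (b β) (fun y => v (a β • siteToE y))
    have hWc := continuous_cubeSmear G r (c β) (b β) (fun y => v (a β • siteToE y))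
    exact mirrorPackage_of_bareFloor G r β (c β) (b β) L hc0 hcL hc hWc hMW hWS hSW 0 (hMF β hβ L hL)

/-- **Clause (i) of `LowerBounds G r a` from {RBLΔ, MF}.** [folklore] -/
theorem lowerBounds_fst_of_bareFloor_chiral (a : ℝ → ℝ) (ha₀ : ∀ β, 0 < a β)
    (v : 𝓢(EuclideanSpace ℝ (Fin 4), ℝ)) (hv : tsupport (v : EuclideanSpace ℝ (Fin 4) → ℝ) ⊆ {y | 0 < y 0})
    {ε : ℝ} (hε : 0 < ε) {β₅ Λ₅ : ℝ}
    (c : ℝ → (Fin 4 → ℤ)) (b : ℝ → ℕ) (p' : ℝ → ℝ)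
    (hgeom : ∀ β, β₅ ≤ β → 1 ≤ c β 0 ∧ ∀ j : Fin 4, (|((c β j : ℤ) : ℝ)| + (b β : ℝ) + 3) * a β ≤ Λ₅)
    (hsupp : ∀ β, β₅ ≤ β → ∀ x : Fin 4 → ℤ, v (a β • siteToE x) ≠ 0 →
      x ∈ cubeSites (c β) (b β) ∧ 2 ≤ depth (c β) (b β) x)
    (hΔ : ∀ β, β₅ ≤ β → ∀ ζ,
      |kerE G r β (c β) (b β) ζ (fun V => ∑ x ∈ cubeSites (c β) (b β), v (a β • siteToE x) *
          ∑ q : {q : Fin 4 × Fin 4 // q.1 < q.2}, plane G r q.1 (if q.1.1 = 0 then x - Pi.single 0 1 else x) V) -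
        kerE G r β (c β) (b β) ζ (fun V => ∑ y ∈ cubeSites (c β) (b β), v (a β • siteToE y) * dens G r y V) -
        p' β| ≤ Real.sqrt ε / 2)
    (hMF : ∀ β, β₅ ≤ β → ∀ L : ℕ, Λ₅ ≤ a β * L →
      4 * ε ≤ torusE G r β L (fun V =>
          (∑ y ∈ cubeSites (c β) (b β), v (a β • siteToE y) * dens G r y (cfgReflect V)) *
            ∑ y ∈ cubeSites (c β) (b β), v (a β • siteToE y) * dens G r y V) -
        torusE G r β L (fun V => ∑ y ∈ cubeSites (c β) (b β), v (a β • siteToE y) * dens G r y (cfgReflect V)) *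
          torusE G r β L (fun V => ∑ y ∈ cubeSites (c β) (b β), v (a β • siteToE y) * dens G r y V)) :
    ∃ (v : 𝓢(EuclideanSpace ℝ (Fin 4), ℝ)) (ε β₅ Λ₅ : ℝ),
      tsupport (v : EuclideanSpace ℝ (Fin 4) → ℝ) ⊆ {y : EuclideanSpace ℝ (Fin 4) | 0 < y 0} ∧ 0 < ε ∧
      ∀ β : ℝ, β₅ ≤ β → ∀ L : ℕ, Λ₅ ≤ a β * L → ε ≤ Q2 G r β L (a β) (thetaTest 4 v) v :=
  ⟨v, ε, max β₅ 0, Λ₅, hv, hε, Q2_floor_of_bareFloor_chiral G r a ha₀ v hε c b p' hgeom hsupp hΔ hMF⟩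

/-- **The two-point conjunct of `UVSeamRec.stub_floorsEngine` (v4-F) from {RBLΔ, MF}** (compact support of the
witness recorded; any `(G, r, a)` — at `(SU(2), rF, a ≍ c₀·uRec)` it is the registered conjunct). [folklore] -/
theorem floorsTwoPoint_of_bareFloor_chiral (a : ℝ → ℝ) (ha₀ : ∀ β, 0 < a β)
    (v : 𝓢(EuclideanSpace ℝ (Fin 4), ℝ)) (hvK : HasCompactSupport (v : EuclideanSpace ℝ (Fin 4) → ℝ))
    (hv : tsupport (v : EuclideanSpace ℝ (Fin 4) → ℝ) ⊆ {y | 0 < y 0})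
    {ε : ℝ} (hε : 0 < ε) {β₅ Λ₅ : ℝ}
    (c : ℝ → (Fin 4 → ℤ)) (b : ℝ → ℕ) (p' : ℝ → ℝ)
    (hgeom : ∀ β, β₅ ≤ β → 1 ≤ c β 0 ∧ ∀ j : Fin 4, (|((c β j : ℤ) : ℝ)| + (b β : ℝ) + 3) * a β ≤ Λ₅)
    (hsupp : ∀ β, β₅ ≤ β → ∀ x : Fin 4 → ℤ, v (a β • siteToE x) ≠ 0 →
      x ∈ cubeSites (c β) (b β) ∧ 2 ≤ depth (c β) (b β) x)
    (hΔ : ∀ β, β₅ ≤ β → ∀ ζ,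
      |kerE G r β (c β) (b β) ζ (fun V => ∑ x ∈ cubeSites (c β) (b β), v (a β • siteToE x) *
          ∑ q : {q : Fin 4 × Fin 4 // q.1 < q.2}, plane G r q.1 (if q.1.1 = 0 then x - Pi.single 0 1 else x) V) -
        kerE G r β (c β) (b β) ζ (fun V => ∑ y ∈ cubeSites (c β) (b β), v (a β • siteToE y) * dens G r y V) -
        p' β| ≤ Real.sqrt ε / 2)
    (hMF : ∀ β, β₅ ≤ β → ∀ L : ℕ, Λ₅ ≤ a β * L →
      4 * ε ≤ torusE G r β L (fun V =>
          (∑ y ∈ cubeSites (c β) (b β), v (a β • siteToE y) * dens G r y (cfgReflect V)) *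
            ∑ y ∈ cubeSites (c β) (b β), v (a β • siteToE y) * dens G r y V) -
        torusE G r β L (fun V => ∑ y ∈ cubeSites (c β) (b β), v (a β • siteToE y) * dens G r y (cfgReflect V)) *
          torusE G r β L (fun V => ∑ y ∈ cubeSites (c β) (b β), v (a β • siteToE y) * dens G r y V)) :
    ∃ (v : 𝓢(EuclideanSpace ℝ (Fin 4), ℝ)) (ε β₅ Λ₅ : ℝ),
      HasCompactSupport (v : EuclideanSpace ℝ (Fin 4) → ℝ) ∧
      tsupport (v : EuclideanSpace ℝ (Fin 4) → ℝ) ⊆ {y : EuclideanSpace ℝ (Fin 4) | 0 < y 0} ∧ 0 < ε ∧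
      ∀ β : ℝ, β₅ ≤ β → ∀ L : ℕ, Λ₅ ≤ a β * L → ε ≤ Q2 G r β L (a β) (thetaTest 4 v) v :=
  ⟨v, ε, max β₅ 0, Λ₅, hvK, hv, hε, Q2_floor_of_bareFloor_chiral G r a ha₀ v hε c b p' hgeom hsupp hΔ hMF⟩

end Bare

/-- **`NT` BY NAME from {RBLΔ, MF} and any clause-(ii) supplier**: for every compact simple `G` (Borel σ-algebra) a
representation `r`, a unit map `a` (`0 < a → 0`), ONE positive-time test function with its cube family, the
chirality-defect response bound (RBLΔ) and the bare mirror floor (MF), plus any supplier of clause (ii), give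
`Summit.QuantumFields.YangMills.Theses.BalabanLadder.NT` (via `lowerBounds_fst_of_bareFloor_chiral`). [folklore] -/
theorem nt_of_bareFloor_chiral
    (h : ∀ (G : Type) [Group G] [TopologicalSpace G] [IsTopologicalGroup G] [CompactSpace G],
      IsCompactSimpleLieGroup G → letI : MeasurableSpace G := borel G; haveI : BorelSpace G := ⟨rfl⟩;
      ∃ (r : LatticeRep G) (a : ℝ → ℝ), (∀ β, 0 < a β) ∧ Tendsto a atTop (𝓝 0) ∧
        (∃ (v : 𝓢(EuclideanSpace ℝ (Fin 4), ℝ)) (ε β₅ Λ₅ : ℝ) (c : ℝ → (Fin 4 → ℤ)) (b : ℝ → ℕ) (p' : ℝ → ℝ),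
          tsupport (v : EuclideanSpace ℝ (Fin 4) → ℝ) ⊆ {y | 0 < y 0} ∧ 0 < ε ∧
          (∀ β, β₅ ≤ β → 1 ≤ c β 0 ∧ ∀ j : Fin 4, (|((c β j : ℤ) : ℝ)| + (b β : ℝ) + 3) * a β ≤ Λ₅) ∧
          (∀ β, β₅ ≤ β → ∀ x : Fin 4 → ℤ, v (a β • siteToE x) ≠ 0 →
            x ∈ cubeSites (c β) (b β) ∧ 2 ≤ depth (c β) (b β) x) ∧
          (∀ β, β₅ ≤ β → ∀ ζ,
            |kerE G r β (c β) (b β) ζ (fun V => ∑ x ∈ cubeSites (c β) (b β), v (a β • siteToE x) *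
                ∑ q : {q : Fin 4 × Fin 4 // q.1 < q.2},
                  plane G r q.1 (if q.1.1 = 0 then x - Pi.single 0 1 else x) V) -
              kerE G r β (c β) (b β) ζ (fun V => ∑ y ∈ cubeSites (c β) (b β), v (a β • siteToE y) * dens G r y V) -
              p' β| ≤ Real.sqrt ε / 2) ∧
          (∀ β, β₅ ≤ β → ∀ L : ℕ, Λ₅ ≤ a β * L →
            4 * ε ≤ torusE G r β L (fun V =>
                (∑ y ∈ cubeSites (c β) (b β), v (a β • siteToE y) * dens G r y (cfgReflect V)) *
                  ∑ y ∈ cubeSites (c β) (b β), v (a β • siteToE y) * dens G r y V) -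
              torusE G r β L (fun V => ∑ y ∈ cubeSites (c β) (b β), v (a β • siteToE y) * dens G r y (cfgReflect V)) *
                torusE G r β L (fun V => ∑ y ∈ cubeSites (c β) (b β), v (a β • siteToE y) * dens G r y V))) ∧
        (∃ (f g h : 𝓢(EuclideanSpace ℝ (Fin 4), ℝ)) (ε β₅ Λ₅ : ℝ), Disjoint (tsupport f) (tsupport g) ∧
          Disjoint (tsupport g) (tsupport h) ∧ Disjoint (tsupport f) (tsupport h) ∧ 0 < ε ∧
          ∀ β : ℝ, β₅ ≤ β → ∀ L : ℕ, Λ₅ ≤ a β * L → ε ≤ |Q3 G r β L (a β) f g h|)) :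
    Summit.QuantumFields.YangMills.Theses.BalabanLadder.NT := by
  intro G _ _ _ _ hG
  letI : MeasurableSpace G := borel G
  haveI : BorelSpace G := ⟨rfl⟩
  obtain ⟨r, a, ha₀, ha, ⟨v, ε, β₅, Λ₅, c, b, p', hv, hε, hgeom, hsupp, hΔ, hMF⟩, h3⟩ := h G hG
  exact ⟨r, a, ha₀, ha, lowerBounds_fst_of_bareFloor_chiral G r a ha₀ v hv hε c b p' hgeom hsupp hΔ hMF, h3⟩

end Summit.QuantumFields.YangMills.Cruxes.NT.MarkovMirror

end
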